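import Summits.NavierStokesRegularity.NavierStokesRegularity.Theorems.ExtremiserTransienceNearExtremalTransienceExtremiserLiouvilleConstantSpeedSecondVariation
import Summits.NavierStokesRegularity.NavierStokesRegularity.Theorems.ExtremiserTransienceNearExtremalTransienceExtremiserLiouvilleConstantSpeedMultiplierStrongEL
import HarnessLib

/-!
# Crux `ExtremiserTransience.NearExtremalTransience` (stmt-NavierStokesRegularity-21883), line `extremiser_liouville`,
# stub K1b — EXACTLY TANGENTIAL SOLENOIDAL TEST FIELDS ON THE TWIST SET, and the second-order condition along them

`--supports stmt-NavierStokesRegularity-21883` (helper).  Author: prover seat `ns-el-k1b` (g3).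

On the twist set `U = {⟪v, curl v⟫ ≠ 0}` of a constant-speed field `v` there is an INFINITE-DIMENSIONAL family of smooth,
compactly supported, divergence-free test fields that are EXACTLY tangential to the constraint sphere, `⟪v, φ⟫ ≡ 0`:
for any `Ψ₀ ∈ C_c^∞(U; ℝ³)` put `g := ⟪v, curl Ψ₀⟫/⟪v, curl v⟫` and
`φ := curl (Ψ₀ − g·v) = curl Ψ₀ − curl(g v)`; since `⟪v, curl(g v)⟫ = g⟪v, curl v⟫ = ⟪v, curl Ψ₀⟫`
(`inner_self_curl_smul`), `⟪v, φ⟫ ≡ 0`, and `φ` is a curl, hence solenoidal.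

* `tangentialTestField_props` : `φ` is `C^∞`, compactly supported, divergence free and `⟪v, φ⟫ ≡ 0`;
* `firstVariation_tangentialTestField_eq_zero` : along such `φ` the first variation of the residue object VANISHES
  (`ℓ(φ) = ∫⟪v,φ⟫dμ = 0` by the multiplier representation) — the KKT inequality is tight with `s = 0`;
* `secondVariation_tangentialTestField_le` : hence the SECOND-ORDER condition of `…ConstantSpeedSecondVariation` applies
  unconditionally: **`J₁(φ)² + 2S·J₂(φ) ≤ κ⋆²[sup‖φ‖²·ZW + M²(a₂(φ)W + 4a₁(φ)c₁(φ) + c₂(φ)Z)]` for every `Ψ₀ ∈ C_c^∞(U;ℝ³)`**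
  (with any bound `P ≥ ‖φ‖²`) — an explicit infinite family of stability inequalities the K1b residue object must satisfy
  (heuristically: the realizable vortex-stretching rate of `v` on tangential test vorticity is bounded by `S/(2Z)` up to the
  palinstrophy penalty; see `Lines/extremiser_liouville_k1b_multiplier.md`).

WHAT THIS IS NOT: necessary conditions on the HYPOTHETICAL K1b residue object; K1b is NOT proved; nothing here proves NS
regularity. [folklore]
-/

noncomputable section

open Set Filter Topology MeasureTheory Metric Function
open scoped ENNReal NNReal Topology InnerProductSpace RealInnerProductSpace ContDiff
open Literature.Analysis.FluidPDE Literature.Analysis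

namespace Summit.NavierStokesRegularity.NavierStokesRegularity.Theorems

-- the problem directory repeats the summit name (`NavierStokesRegularity/NavierStokesRegularity`)
set_option linter.dupNamespace false

namespace ExtremiserLiouville

open DepletionLadder.KStar DepletionLadder.KStar.HalfSpace

variable {v : E3 → E3} {M : ℝ} {μ : Measure E3}

/-- **Exactly tangential solenoidal test fields.**  For `v ∈ C^∞` and `Ψ₀ ∈ C_c^∞` supported in the twist set, the field
`φ = curl (Ψ₀ − (⟪v,curl Ψ₀⟫/⟪v,curl v⟫)·v)` is `C^∞`, compactly supported, divergence free and pointwise orthogonal to `v`.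
[folklore] -/
theorem tangentialTestField_props (hv : ContDiff ℝ ∞ v) {Ψ₀ : E3 → E3} (hΨ : ContDiff ℝ ∞ Ψ₀)
    (hΨc : HasCompactSupport Ψ₀) (hΨU : tsupport Ψ₀ ⊆ {x | ⟪v x, curl v x⟫_ℝ ≠ 0}) :
    ContDiff ℝ ∞ (curl fun y => Ψ₀ y - (⟪v y, curl Ψ₀ y⟫_ℝ / ⟪v y, curl v y⟫_ℝ) • v y) ∧
      HasCompactSupport (curl fun y => Ψ₀ y - (⟪v y, curl Ψ₀ y⟫_ℝ / ⟪v y, curl v y⟫_ℝ) • v y) ∧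
      VectorCalculus.IsDivFree (curl fun y => Ψ₀ y - (⟪v y, curl Ψ₀ y⟫_ℝ / ⟪v y, curl v y⟫_ℝ) • v y) ∧
      ∀ x, ⟪v x, curl (fun y => Ψ₀ y - (⟪v y, curl Ψ₀ y⟫_ℝ / ⟪v y, curl v y⟫_ℝ) • v y) x⟫_ℝ = 0 := by
  have hh : ContDiff ℝ ∞ fun x => ⟪v x, curl v x⟫_ℝ := hv.inner ℝ (contDiff_curl_top hv)
  have hcΨ : ContDiff ℝ ∞ (curl Ψ₀) := contDiff_curl_top hΨ
  have hnum : ContDiff ℝ ∞ fun x => ⟪v x, curl Ψ₀ x⟫_ℝ := hv.inner ℝ hcΨ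
  have hnumc : HasCompactSupport fun x => ⟪v x, curl Ψ₀ x⟫_ℝ :=
    hasCompactSupport_inner_of_right v (hasCompactSupport_curl hΨc)
  have htsn : tsupport (fun x => ⟪v x, curl Ψ₀ x⟫_ℝ) ⊆ {x | ⟪v x, curl v x⟫_ℝ ≠ 0} := by
    refine (closure_mono fun x hx => ?_).trans ((tsupport_curl_subset Ψ₀).trans hΨU)
    rw [mem_support] at hx ⊢
    intro h0
    exact hx (by rw [h0, inner_zero_right])
  -- the coefficient `g` is smooth with compact support
  have hg : ContDiff ℝ ∞ fun x => ⟪v x, curl Ψ₀ x⟫_ℝ / ⟪v x, curl v x⟫_ℝ :=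
    contDiff_div_of_ne_zero_on_tsupport hnum hh fun x hx => htsn hx
  have hgc : HasCompactSupport fun x => ⟪v x, curl Ψ₀ x⟫_ℝ / ⟪v x, curl v x⟫_ℝ :=
    hnumc.mono fun x hx => by
      rw [mem_support] at hx ⊢
      intro h0
      exact hx (by rw [h0, zero_div])
  have hΨ' : ContDiff ℝ ∞ fun y => Ψ₀ y - (⟪v y, curl Ψ₀ y⟫_ℝ / ⟪v y, curl v y⟫_ℝ) • v y := hΨ.sub (hg.smul hv)
  have hΨ'c : HasCompactSupport fun y => Ψ₀ y - (⟪v y, curl Ψ₀ y⟫_ℝ / ⟪v y, curl v y⟫_ℝ) • v y :=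
    hΨc.sub hgc.smul_right
  refine ⟨contDiff_curl_top hΨ', hasCompactSupport_curl hΨ'c,
    fun x => divergence_curl_eq_zero_holds _ (hΨ'.of_le (by norm_cast)) x, fun x => ?_⟩
  -- tangency
  have hΨd : DifferentiableAt ℝ Ψ₀ x := (hΨ.differentiable (by simp)) x
  have hgd : DifferentiableAt ℝ (fun y => ⟪v y, curl Ψ₀ y⟫_ℝ / ⟪v y, curl v y⟫_ℝ) x := (hg.differentiable (by simp)) x
  have hvd : DifferentiableAt ℝ v x := (hv.differentiable (by simp)) x
  have hsm : DifferentiableAt ℝ (fun y => (⟪v y, curl Ψ₀ y⟫_ℝ / ⟪v y, curl v y⟫_ℝ) • v y) x := by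
    exact hgd.smul hvd
  have hsub : curl (fun y => Ψ₀ y - (⟪v y, curl Ψ₀ y⟫_ℝ / ⟪v y, curl v y⟫_ℝ) • v y) x =
      curl Ψ₀ x - curl (fun y => (⟪v y, curl Ψ₀ y⟫_ℝ / ⟪v y, curl v y⟫_ℝ) • v y) x := curl_sub hΨd hsm
  rw [hsub, inner_sub_right, inner_self_curl_smul hgd hvd]
  by_cases hx : ⟪v x, curl v x⟫_ℝ = 0
  · have hxn : x ∉ tsupport fun x => ⟪v x, curl Ψ₀ x⟫_ℝ := fun h => htsn h hx
    have h0 : ⟪v x, curl Ψ₀ x⟫_ℝ = 0 := image_eq_zero_of_notMem_tsupport (f := fun x => ⟪v x, curl Ψ₀ x⟫_ℝ) hxn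
    rw [h0, zero_div, zero_mul, sub_zero]
  · rw [div_mul_cancel₀ _ hx, sub_self]

/-- **The first variation vanishes along tangential test fields**: with a multiplier `μ` (`ℓ(φ) = ∫⟪v,φ⟫dμ`) and
`⟪v, φ⟫ ≡ 0`, `ℓ(φ) = 0`. [folklore] -/
theorem firstVariation_tangentialTestField_eq_zero (hv : ContDiff ℝ ∞ v)
    (hμ : ∀ φ : E3 → E3, ContDiff ℝ ∞ φ → HasCompactSupport φ → VectorCalculus.IsDivFree φ →
      Jst v * J1 v φ - kStar ^ 2 * M ^ 2 * (Wpa v * A1 v φ + Zen v * C1 v φ) = ∫ x, ⟪v x, φ x⟫_ℝ ∂μ)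
    {Ψ₀ : E3 → E3} (hΨ : ContDiff ℝ ∞ Ψ₀) (hΨc : HasCompactSupport Ψ₀)
    (hΨU : tsupport Ψ₀ ⊆ {x | ⟪v x, curl v x⟫_ℝ ≠ 0}) :
    Jst v * J1 v (curl fun y => Ψ₀ y - (⟪v y, curl Ψ₀ y⟫_ℝ / ⟪v y, curl v y⟫_ℝ) • v y) -
      kStar ^ 2 * M ^ 2 * (Wpa v * A1 v (curl fun y => Ψ₀ y - (⟪v y, curl Ψ₀ y⟫_ℝ / ⟪v y, curl v y⟫_ℝ) • v y) +
        Zen v * C1 v (curl fun y => Ψ₀ y - (⟪v y, curl Ψ₀ y⟫_ℝ / ⟪v y, curl v y⟫_ℝ) • v y)) = 0 := by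
  obtain ⟨hφ, hφc, hφdiv, htan⟩ := tangentialTestField_props hv hΨ hΨc hΨU
  rw [hμ _ hφ hφc hφdiv]
  simp [htan]

/-- **SECOND-ORDER CONDITION ALONG TANGENTIAL TEST FIELDS (unconditional).**  For a constant-speed extended extremiser `v`
and every `Ψ₀ ∈ C_c^∞` supported in the twist set, the tangential solenoidal field `φ = curl(Ψ₀ − (⟪v,curl Ψ₀⟫/⟪v,curl v⟫)v)`
satisfies `J₁(φ)² + 2S·J₂(φ) ≤ κ⋆²[P·ZW + M²(a₂(φ)W + 4a₁(φ)c₁(φ) + c₂(φ)Z)]` for any bound `‖φ‖² ≤ P`. [folklore] -/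
theorem secondVariation_tangentialTestField_le (hv : ContDiff ℝ ∞ v) (hdiv : VectorCalculus.IsDivFree v) {M B : ℝ}
    (hMpos : 0 < M) (hM : ∀ x, ‖v x‖ = M) (hB : ∀ x, ‖fderiv ℝ v x‖ ≤ B)
    (h1 : ∫⁻ x, ‖iteratedFDeriv ℝ 1 v x‖ₑ ^ 2 < ⊤) (h2 : ∫⁻ x, ‖iteratedFDeriv ℝ 2 v x‖ₑ ^ 2 < ⊤)
    (hatt : |Jst v| = kStar * M * Real.sqrt (Zen v) * Real.sqrt (Wpa v))
    {Ψ₀ : E3 → E3} (hΨ : ContDiff ℝ ∞ Ψ₀) (hΨc : HasCompactSupport Ψ₀)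
    (hΨU : tsupport Ψ₀ ⊆ {x | ⟪v x, curl v x⟫_ℝ ≠ 0}) {P : ℝ}
    (hP : ∀ x, ‖curl (fun y => Ψ₀ y - (⟪v y, curl Ψ₀ y⟫_ℝ / ⟪v y, curl v y⟫_ℝ) • v y) x‖ ^ 2 ≤ P) :
    let φ : E3 → E3 := curl fun y => Ψ₀ y - (⟪v y, curl Ψ₀ y⟫_ℝ / ⟪v y, curl v y⟫_ℝ) • v y
    J1 v φ ^ 2 + 2 * Jst v * (∫ x, (⟪curl φ x, fderiv ℝ φ x (curl v x)⟫_ℝ + ⟪curl φ x, fderiv ℝ v x (curl φ x)⟫_ℝ +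
        ⟪curl v x, fderiv ℝ φ x (curl φ x)⟫_ℝ)) ≤
      kStar ^ 2 * (P * Zen v * Wpa v +
        M ^ 2 * ((∫ x, ‖curl φ x‖ ^ 2) * Wpa v + 4 * A1 v φ * C1 v φ +
          (∫ x, frobeniusNormSq (fderiv ℝ (curl φ) x)) * Zen v)) := by
  intro φ
  obtain ⟨hφ, hφc, hφdiv, htan⟩ := tangentialTestField_props hv hΨ hΨc hΨU
  obtain ⟨μ, hfin, -, hμ⟩ := exists_multiplierMeasure hv hdiv hMpos hM hB h1 h2 hatt
  have hℓ := firstVariation_tangentialTestField_eq_zero hv hμ hΨ hΨc hΨU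
  exact ext_secondVariation_le_of_inward hv hdiv hM hB h1 h2 hatt hφ hφc hφdiv (fun x => (htan x).le) hP hℓ

end ExtremiserLiouville

end Summit.NavierStokesRegularity.NavierStokesRegularity.Theorems

end
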